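import Literature.Geometry.Lorentzian.KerrSchildDecay
import Literature.Geometry.Lorentzian.KerrSliceFacts
import Literature.Geometry.Lorentzian.KerrDataSchwarzschildExtrinsic
import Literature.Geometry.Lorentzian.ModelDataProofs
import Literature.Geometry.Lorentzian.AFEndRestrict
import HarnessLib

/-!
# The Kerr–Schild slice data are asymptotically flat of order one (all spins)

Discharge of the named fact `Kerr.isAsymptoticallyFlat_data` (`KerrData.lean`): for every mass
`M ≥ 0`, every spin parameter `a` and every inner radius `r₀`, the Kerr initial data set
`Kerr.data M a r₀ hM = (h, k)` is asymptotically flat of order `1` on the end `Kerr.afEnd a r₀`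
(`AFEnd.IsAsymptoticallyFlat`, Bartnik 1986, Def. 2.1, with `k` added as in Bartnik–Isenberg 2004,
§2): in the Kerr–Schild Cartesian chart of the end,
`h_ij − δ_ij = 2H ℓ_i ℓ_j = O₂(ρ⁻¹)` and `k_ij = O₁(ρ⁻²)` — indeed `O_k` for every `k`.

The proof reads the chart components through the tautological chart of the end
(`Kerr.hCoeff_afEnd_data_apply`: `h_ij(z) = g_{(0,z)}((0, eᵢ), (0, eⱼ))`;
`Kerr.kCoeff_afEnd_data_apply`: `k_ij(z) = K_ν((0, eᵢ), (0, eⱼ))`), expresses the second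
fundamental form of the slice in coordinates
(`Kerr.secondFundamentalForm_sliceEmbed_eq`: `K_ν(v, w) = g(DN v, w̃) + ½ K(N, ṽ, w̃)` with the
Koszul form `K` of the components `G = η + 2Hℓ⊗ℓ`, O'Neill 1983, Ch. 4, Lemma 4.1 and Ch. 3,
Prop. 3.13, through `OpensChart.secondFundamentalForm_eq_of_repr`; stationarity
`∂_{t*} G = 0` reduces all derivatives to derivatives along the slice,
`Kerr.fderiv_bilin_ofTimeSpace`), and feeds in the symbol estimates of `KerrSchildDecay.lean`
(`G − η ∈ O_k(ρ⁻¹)`, `N − ∂_{t*} ∈ O_k(ρ⁻¹)`, hence `DG, DN ∈ O_k(ρ⁻²)`) through the Leibniz rules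
of the symbol calculus (`DecaySymbols*.lean`).

* `Kerr.hCoeff_afEnd_data_apply`, `Kerr.kCoeff_afEnd_data_apply` — the chart components of the
  Kerr data on the end are the values of `g` and of `K_ν` on the vectors `(0, v)`;
* `Kerr.fderiv_bilin_ofTimeSpace` — `DG_{(0,z)}(U) = D(G ∘ (0,·))_z(U⃗)` (stationarity);
* `Kerr.secondFundamentalForm_sliceEmbed_eq` — the coordinate formula for `K_ν` (all spins);
* `Kerr.isBigOSmooth_hCoeff_sub`, `Kerr.isBigOSmooth_kCoeff` — `h − δ ∈ O_k(ρ⁻¹)`,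
  `k ∈ O_k(ρ⁻²)` on the Kerr end, for every `k`;
* `Kerr.isAsymptoticallyFlat_afEnd_data` and **`Kerr.isAsymptoticallyFlat_data_holds`** — the
  named fact, verbatim.

Cook, Living Rev. Relativ. 3 (2000) 5, §3.2.2, (55)–(57); García-Parrado–Valiente Kroon, J. Geom.
Phys. 58 (2008), §5; Bartnik, CPAM 39 (1986), Def. 2.1. Everything is proved; no definitions, no
named facts.

## References

* R. Bartnik, *The mass of an asymptotically flat manifold*, CPAM 39 (1986), Def. 2.1.
* G. B. Cook, *Initial data for numerical relativity*, Living Rev. Relativ. 3 (2000) 5, §3.2.2.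
* A. García-Parrado, J. A. Valiente Kroon, *Kerr initial data*, J. Geom. Phys. 58 (2008), §5.
* B. O'Neill, *Semi-Riemannian geometry*, Academic Press 1983, Ch. 3, Prop. 3.13; Ch. 4, Lemma 4.1.
-/

noncomputable section

open Set Filter Asymptotics Bornology Topology Bundle TopologicalSpace Manifold
open scoped ContDiff RealInnerProductSpace Manifold

-- iterated operator-norm spaces over `E3`/`E4` (values of the derivatives of the chart components):
-- nested instance problems and slow syntheses through `PiLp` (as in `RicciChartDecay.lean`)
set_option maxSynthPendingDepth 3
set_option synthInstance.maxHeartbeats 200000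

namespace Literature.Geometry.Lorentzian

namespace Kerr

/-! ### The chart components of the Kerr data on the end `Kerr.afEnd` -/

section Coeff

/-- The inverse chart of the Kerr end is the identity on coordinates (by `rfl`; the same statement as
`Kerr.coe_dataChart_afEnd` of `KerrStationaryBlackHole.lean`, not imported here). Bartnik 1986, §1
(structure of infinity). [cite: Bartnik1986, §1] -/
theorem coe_coe_dataChart_afEnd (a r₀ : ℝ) (y : exteriorRegion (afEnd a r₀).R) :
    (((afEnd a r₀).dataChart y : slice a r₀) : E3) = y := rfl

/-- The inverse chart of the Kerr end, as a point of the slice (by `rfl`). [cite: Bartnik1986, §1] -/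
theorem dataChart_afEnd (a r₀ : ℝ) (y : exteriorRegion (afEnd a r₀).R) :
    (afEnd a r₀).dataChart y = ⟨y, mem_slice_of_lt_norm y.2⟩ := rfl

/-- **The inverse chart of the Kerr end has identity differential** (`OpensChart.mfderiv_apply_of_coe_eq`).
[cite: Bartnik1986, §1] -/
theorem mfderiv_dataChart_afEnd_apply (a r₀ : ℝ) (y : exteriorRegion (afEnd a r₀).R) (v : E3) :
    mfderiv (𝓡 3) (𝓡 3) (afEnd a r₀).dataChart y v = v :=
  OpensChart.mfderiv_apply_of_coe_eq _ (coe_coe_dataChart_afEnd a r₀) y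
    (((afEnd a r₀).contMDiff_dataChart y).mdifferentiableAt (by simp)) v

variable [Facts] [SliceFacts]

/-- **The chart components of the Kerr metric on the end are the values of `g` on vectors
`(0, v)`**: for `‖z‖ > R`, `h_ij(z) vⁱ wʲ = g_{(0,z)}((0, v), (0, w))` (`= ⟪v, w⟫ + 2H ℓ(0,v) ℓ(0,w)`).
Cook 2000, §3.2.2, (55); Bartnik 1986, (1.3). [cite: Cook2000, §3.2.2 (55)] -/
theorem hCoeff_afEnd_data_apply {M : ℝ} (hM : 0 ≤ M) (a r₀ : ℝ) {z : E3} (hz : afRadius a r₀ < ‖z‖)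
    (v w : E3) :
    AFEnd.hCoeff (afEnd a r₀) (data M a r₀ hM) z v w =
      bilin M a (E4.ofTimeSpace 0 z) (E4.ofTimeSpace 0 v) (E4.ofTimeSpace 0 w) := by
  have hz' : (afEnd a r₀).R < ‖z‖ := hz
  have h := AFEnd.hCoeff_apply_eq_dataChart (afEnd a r₀) (data M a r₀ hM) ⟨z, hz'⟩ v w
  rw [mfderiv_dataChart_afEnd_apply, mfderiv_dataChart_afEnd_apply] at h
  refine h.trans ?_
  -- `h = (sliceEmbed)^* g` on the point `⟨z, _⟩` of the slice
  have key : ∀ (p : slice a r₀) (v' w' : E3),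
      (data M a r₀ hM).h.inner p v' w' =
        bilin M a (E4.ofTimeSpace 0 (p : E3)) (E4.ofTimeSpace 0 v') (E4.ofTimeSpace 0 w') := by
    intro p v' w'
    rw [data_h_inner, PseudoRiemannianMetric.inducedBilin_apply, mfderiv_sliceEmbed]
    rfl
  exact key _ v w

/-- **The chart components of `k` on the end are the values of `K_ν` on vectors `(0, v)`**:
for `‖z‖ > R`, `k_ij(z) vⁱ wʲ = k_{⟨z⟩}(v, w) = K_ν((0,v), (0,w))` (`Kerr.sliceK`).
Cook 2000, §3.2.2, (57). [cite: Cook2000, §3.2.2 (57)] -/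
theorem kCoeff_afEnd_data_apply {M : ℝ} (hM : 0 ≤ M) (a r₀ : ℝ) {z : E3} (hz : afRadius a r₀ < ‖z‖)
    (v w : E3) :
    AFEnd.kCoeff (afEnd a r₀) (data M a r₀ hM) z v w = sliceK M a r₀ ⟨z, mem_slice_of_lt_norm hz⟩ v w := by
  have hz' : (afEnd a r₀).R < ‖z‖ := hz
  have h := AFEnd.kCoeff_apply_eq_dataChart (afEnd a r₀) (data M a r₀ hM) ⟨z, hz'⟩ v w
  rw [mfderiv_dataChart_afEnd_apply, mfderiv_dataChart_afEnd_apply] at h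
  exact h

end Coeff

/-! ### The second fundamental form of the slice in coordinates -/

section SecondFF

variable (M a : ℝ)

/-- **Stationarity reduces derivatives of the components to derivatives along the slice**:
`DG_{(0,z)}(U) = D(z ↦ G(0, z))_z(U⃗)` for the Kerr–Schild components `G = η + 2Hℓ⊗ℓ` (no
component depends on `t*`: `G(x) = G(0, x⃗)`, `Kerr.bilin_add_smul_basisVector_zero`), wherever
`r > 0`. Kerr–Schild 1965, §2. [cite: KerrSchild1965, §2] -/
theorem fderiv_bilin_ofTimeSpace {z : E3} (hz : 0 < radius a (E4.ofTimeSpace 0 z)) (U : E4) :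
    fderiv ℝ (bilin M a) (E4.ofTimeSpace 0 z) U =
      fderiv ℝ (fun z : E3 ↦ bilin M a (E4.ofTimeSpace 0 z)) z (E4.spatial U) := by
  -- stationarity: `G((0, z) + tU) = G(0, z + t U⃗)`
  have hstat : ∀ t : ℝ, bilin M a (E4.ofTimeSpace 0 z + t • U) =
      bilin M a (E4.ofTimeSpace 0 (z + t • E4.spatial U)) := fun t ↦ by
    have hsplit : E4.ofTimeSpace 0 z + t • U =
        E4.ofTimeSpace 0 (z + t • E4.spatial U) + (t * E4.time U) • E4.basisVector 0 := by
      conv_lhs => rw [← E4.ofTimeSpace_time_spatial U]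
      rw [E4.ofTimeSpace_eq_smul_add' (E4.time U), E4.ofTimeSpace_eq_smul_add' 0,
        E4.ofTimeSpace_eq_smul_add' 0, map_add, map_smul, zero_smul, zero_add, zero_add,
        smul_add, smul_smul]
      abel
    rw [hsplit, bilin_add_smul_basisVector_zero]
  -- both sides are the derivative at `t = 0` of the same curve
  have hG : DifferentiableAt ℝ (bilin M a) (E4.ofTimeSpace 0 z) :=
    (contDiffAt_bilin M a hz (n := 1)).differentiableAt one_ne_zero
  have hO : ContDiff ℝ 1 (E4.ofTimeSpace 0) := contMDiff_iff_contDiff.mp (E4.contMDiff_ofTimeSpace 0 1)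
  have hGs : DifferentiableAt ℝ (fun z : E3 ↦ bilin M a (E4.ofTimeSpace 0 z)) z :=
    ((contDiffAt_bilin M a hz (n := 1)).comp z hO.contDiffAt).differentiableAt one_ne_zero
  have h1 : HasLineDerivAt ℝ (bilin M a) (fderiv ℝ (bilin M a) (E4.ofTimeSpace 0 z) U)
      (E4.ofTimeSpace 0 z) U := hG.hasFDerivAt.hasLineDerivAt U
  have h2 : HasLineDerivAt ℝ (fun z : E3 ↦ bilin M a (E4.ofTimeSpace 0 z))
      (fderiv ℝ (fun z : E3 ↦ bilin M a (E4.ofTimeSpace 0 z)) z (E4.spatial U)) z (E4.spatial U) :=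
    hGs.hasFDerivAt.hasLineDerivAt (E4.spatial U)
  have h2' : HasLineDerivAt ℝ (bilin M a)
      (fderiv ℝ (fun z : E3 ↦ bilin M a (E4.ofTimeSpace 0 z)) z (E4.spatial U))
      (E4.ofTimeSpace 0 z) U := by
    show HasDerivAt (fun t : ℝ ↦ bilin M a (E4.ofTimeSpace 0 z + t • U)) _ 0
    rw [show (fun t : ℝ ↦ bilin M a (E4.ofTimeSpace 0 z + t • U)) =
      fun t : ℝ ↦ bilin M a (E4.ofTimeSpace 0 (z + t • E4.spatial U)) from funext hstat]
    exact h2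
  exact h1.unique h2'

/-- **The second fundamental form of the Kerr–Schild slice in coordinates, for every spin.** With
`G = η + 2Hℓ⊗ℓ` read along the slice, `Gₛ(z) = G(0, z)`, the unit-normal representative
`N(z) = (1 + 2H)^{-1/2} V(0, z)` and `ṽ = (0, v)`, `w̃ = (0, w)`:
`K_ν(v, w) = Gₛ(z)(DN_z v, w̃) + ½ (DGₛ_z(v)(N, w̃) + DGₛ_z(N⃗)(w̃, ṽ) − DGₛ_z(w)(ṽ, N))`
— `K_ν(v, w) = g(DN v + Γ(N)(ṽ), w̃)` (`OpensChart.secondFundamentalForm_eq_of_repr`, O'Neill 1983,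
Ch. 4, Lemma 4.1), `g(Γ(N)(ṽ), w̃) = ½ K(N, ṽ, w̃)` (`OpensChart.val_christoffel_const`, O'Neill
1983, Ch. 3, Prop. 3.13) and stationarity (`fderiv_bilin_ofTimeSpace`). For `M ≥ 0` (so that `N`
is smooth on the slice). [cite: ONeill1983, Ch. 4, Lemma 4.1] -/
theorem secondFundamentalForm_sliceEmbed_eq [Facts] {M : ℝ} (hM : 0 ≤ M) {a r₀ : ℝ}
    [(smoothMetric M a r₀).HasLeviCivita] (y : slice a r₀) (v w : E3) :
    (smoothMetric M a r₀).secondFundamentalForm 𝓘(ℝ, E3) (sliceEmbed a r₀) (sliceNormal M a r₀) y v w =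
      bilin M a (E4.ofTimeSpace 0 y)
          (fderiv ℝ (fun z : E3 ↦ (√(1 + 2 * scalarH M a (E4.ofTimeSpace 0 z)))⁻¹ •
            timeVector M a (E4.ofTimeSpace 0 z)) y v) (E4.ofTimeSpace 0 w) +
        2⁻¹ * (fderiv ℝ (fun z : E3 ↦ bilin M a (E4.ofTimeSpace 0 z)) y v
              ((√(1 + 2 * scalarH M a (E4.ofTimeSpace 0 y)))⁻¹ • timeVector M a (E4.ofTimeSpace 0 y))
              (E4.ofTimeSpace 0 w) +
            fderiv ℝ (fun z : E3 ↦ bilin M a (E4.ofTimeSpace 0 z)) y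
              (E4.spatial ((√(1 + 2 * scalarH M a (E4.ofTimeSpace 0 y)))⁻¹ •
                timeVector M a (E4.ofTimeSpace 0 y)))
              (E4.ofTimeSpace 0 w) (E4.ofTimeSpace 0 v) -
            fderiv ℝ (fun z : E3 ↦ bilin M a (E4.ofTimeSpace 0 z)) y w (E4.ofTimeSpace 0 v)
              ((√(1 + 2 * scalarH M a (E4.ofTimeSpace 0 y)))⁻¹ • timeVector M a (E4.ofTimeSpace 0 y))) := by
  set N : E3 → E4 := fun z ↦ (√(1 + 2 * scalarH M a (E4.ofTimeSpace 0 z)))⁻¹ •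
    timeVector M a (E4.ofTimeSpace 0 z) with hN_def
  have hr : 0 < radius a (E4.ofTimeSpace 0 (y : E3)) :=
    radius_pos_of_mem_region (mem_slice_iff_ofTimeSpace_mem_region.1 y.2)
  have hν : ∀ y' : slice a r₀, sliceNormal M a r₀ y' = N y' := fun y' ↦ rfl
  have hΦ : DifferentiableAt ℝ (E4.ofTimeSpace 0) (y : E3) := (hasFDerivAt_ofTimeSpace_zero _).differentiableAt
  have hN : DifferentiableAt ℝ N (y : E3) :=
    (contDiffAt_sliceNormalRep hM a hr (n := 1)).differentiableAt one_ne_zero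
  have hGd : DifferentiableAt ℝ (bilin M a) (sliceEmbed a r₀ y : E4) :=
    (contDiffAt_bilin M a hr (n := 1)).differentiableAt one_ne_zero
  rw [OpensChart.secondFundamentalForm_eq_of_repr (g := (smoothMetric M a r₀).toPseudoRiemannianMetric)
    (G := bilin M a) (smoothMetric_val M a r₀) (f := sliceEmbed a r₀) (Φ := E4.ofTimeSpace 0)
    (fun _ ↦ rfl) hν hΦ hN hGd v w, fderiv_ofTimeSpace_zero, fderiv_ofTimeSpace_zero]
  -- the Christoffel term
  have hΓ : bilin M a (E4.ofTimeSpace 0 y) (OpensChart.christoffel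
      (smoothMetric M a r₀).toPseudoRiemannianMetric (bilin M a) (sliceEmbed a r₀ y)
      (N y) (E4.ofTimeSpace 0 v)) (E4.ofTimeSpace 0 w) =
      2⁻¹ * OpensChart.koszulForm (bilin M a) (E4.ofTimeSpace 0 y) (N y)
        (E4.ofTimeSpace 0 v) (E4.ofTimeSpace 0 w) :=
    OpensChart.val_christoffel_const (g := (smoothMetric M a r₀).toPseudoRiemannianMetric)
      (G := bilin M a) (sliceEmbed a r₀ y) (N y) (E4.ofTimeSpace 0 v) (E4.ofTimeSpace 0 w)
  show bilin M a (E4.ofTimeSpace 0 y) (fderiv ℝ N y v + OpensChart.christoffel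
      (smoothMetric M a r₀).toPseudoRiemannianMetric (bilin M a) (sliceEmbed a r₀ y)
      (N y) (E4.ofTimeSpace 0 v)) (E4.ofTimeSpace 0 w) = _
  rw [map_add, _root_.add_apply, hΓ, OpensChart.koszulForm_apply,
    fderiv_bilin_ofTimeSpace M a hr, fderiv_bilin_ofTimeSpace M a hr,
    fderiv_bilin_ofTimeSpace M a hr, E4.spatial_ofTimeSpace, E4.spatial_ofTimeSpace]

end SecondFF

/-! ### Decay of the chart components -/

section Decay

variable (M a : ℝ)

/-- **`DGₛ ∈ O_k(ρ⁻²)`**: the derivative along the slice of the Kerr–Schild components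
(`Gₛ − η ∈ O_{k+1}(ρ⁻¹)`, `IsBigOSmooth.fderiv`). Cook 2000, §3.2.2 (`∂h = O(r⁻²)`).
[cite: Cook2000, §3.2.2] -/
theorem isBigOSmooth_fderiv_bilin_ofTimeSpace (k : ℕ) :
    IsBigOSmooth k (-2) (fderiv ℝ fun z : E3 ↦ bilin M a (E4.ofTimeSpace 0 z)) := by
  have h := (isBigOSmooth_bilin_sub_ofTimeSpace M a (k + 1)).fderiv
  rw [show (-1 : ℝ) - 1 = -2 by norm_num] at h
  exact h.congr fun z ↦ fderiv_sub_const _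

/-- **`DN ∈ O_k(ρ⁻²)`** for the unit-normal representative `N = (1 + 2H)^{-1/2} V`
(`N − ∂_{t*} ∈ O_{k+1}(ρ⁻¹)`). Cook 2000, §3.2.2. [cite: Cook2000, §3.2.2] -/
theorem isBigOSmooth_fderiv_sliceNormalRep_ofTimeSpace (k : ℕ) :
    IsBigOSmooth k (-2) (fderiv ℝ fun z : E3 ↦
      (√(1 + 2 * scalarH M a (E4.ofTimeSpace 0 z)))⁻¹ • timeVector M a (E4.ofTimeSpace 0 z)) := by
  have h := (isBigOSmooth_sliceNormalRep_sub_ofTimeSpace M a (k + 1)).fderiv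
  rw [show (-1 : ℝ) - 1 = -2 by norm_num] at h
  exact h.congr fun z ↦ fderiv_sub_const _

/-- **The coordinate expression of `K_ν` is a symbol of order `ρ⁻²`** (every spin, every `k`): each
term of `Gₛ(DN v, w̃) + ½ (DGₛ(v)(N, w̃) + DGₛ(N⃗)(w̃, ṽ) − DGₛ(w)(ṽ, N))` pairs one factor of
order `ρ⁻²` (`DN` or `DGₛ`) with factors of order `0` (`Gₛ`, `N`, constants), by the bilinear
Leibniz rules of the symbol calculus. Cook 2000, §3.2.2, (57) (`k = O(r⁻²)`).
[cite: Cook2000, §3.2.2 (57)] -/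
theorem isBigOSmooth_secondFundamentalFormRep (k : ℕ) (v w : E3) :
    IsBigOSmooth k (-2) fun z : E3 ↦
      bilin M a (E4.ofTimeSpace 0 z)
          (fderiv ℝ (fun z : E3 ↦ (√(1 + 2 * scalarH M a (E4.ofTimeSpace 0 z)))⁻¹ •
            timeVector M a (E4.ofTimeSpace 0 z)) z v) (E4.ofTimeSpace 0 w) +
        2⁻¹ * (fderiv ℝ (fun z : E3 ↦ bilin M a (E4.ofTimeSpace 0 z)) z v
              ((√(1 + 2 * scalarH M a (E4.ofTimeSpace 0 z)))⁻¹ • timeVector M a (E4.ofTimeSpace 0 z))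
              (E4.ofTimeSpace 0 w) +
            fderiv ℝ (fun z : E3 ↦ bilin M a (E4.ofTimeSpace 0 z)) z
              (E4.spatial ((√(1 + 2 * scalarH M a (E4.ofTimeSpace 0 z)))⁻¹ •
                timeVector M a (E4.ofTimeSpace 0 z)))
              (E4.ofTimeSpace 0 w) (E4.ofTimeSpace 0 v) -
            fderiv ℝ (fun z : E3 ↦ bilin M a (E4.ofTimeSpace 0 z)) z w (E4.ofTimeSpace 0 v)
              ((√(1 + 2 * scalarH M a (E4.ofTimeSpace 0 z)))⁻¹ • timeVector M a (E4.ofTimeSpace 0 z))) := by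
  have hG := isBigOSmooth_bilin_ofTimeSpace M a k
  have hDG := isBigOSmooth_fderiv_bilin_ofTimeSpace M a k
  have hN := isBigOSmooth_sliceNormalRep_ofTimeSpace M a k
  have hDN := isBigOSmooth_fderiv_sliceNormalRep_ofTimeSpace M a k
  have hA := (hG.clm_apply (hDN.clm_apply_const v)).clm_apply_const (E4.ofTimeSpace 0 w)
  have hB₁ := ((hDG.clm_apply_const v).clm_apply hN).clm_apply_const (E4.ofTimeSpace 0 w)
  have hB₂ := ((hDG.clm_apply (hN.clm_comp_left E4.spatial)).clm_apply_const
    (E4.ofTimeSpace 0 w)).clm_apply_const (E4.ofTimeSpace 0 v)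
  have hB₃ := ((hDG.clm_apply_const w).clm_apply_const (E4.ofTimeSpace 0 v)).clm_apply hN
  rw [zero_add] at hA
  rw [show (-2 : ℝ) + 0 = -2 by norm_num] at hB₁ hB₂ hB₃
  exact hA.add (((hB₁.add hB₂).sub hB₃).const_mul 2⁻¹)

variable [Facts] [SliceFacts]

/-- **`h − δ ∈ O_k(ρ⁻¹)` on the Kerr end**, for every spin and every `k`: componentwise
`h_ij(z) − δ_ij = (g − η)_{(0,z)}((0, eᵢ), (0, eⱼ)) = 2H ℓᵢ ℓⱼ` far out (`hCoeff_afEnd_data_apply`,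
`η((0,v),(0,w)) = ⟪v, w⟫`), and `g − η ∈ O_k(ρ⁻¹)`. Cook 2000, §3.2.2, (55); Bartnik 1986,
Def. 2.1. [cite: Cook2000, §3.2.2 (55)] -/
theorem isBigOSmooth_hCoeff_sub {M : ℝ} (hM : 0 ≤ M) (a r₀ : ℝ) (k : ℕ) :
    IsBigOSmooth k (-1) fun z : E3 ↦
      AFEnd.hCoeff (afEnd a r₀) (data M a r₀ hM) z - (innerSL ℝ : E3 →L[ℝ] E3 →L[ℝ] ℝ) := by
  refine IsBigOSmooth.of_bilinForm_apply (EuclideanSpace.basisFun (Fin 3) ℝ) fun i j ↦ ?_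
  have h := ((isBigOSmooth_bilin_sub_ofTimeSpace M a k).clm_apply_const
    (E4.ofTimeSpace 0 (EuclideanSpace.basisFun (Fin 3) ℝ i))).clm_apply_const
    (E4.ofTimeSpace 0 (EuclideanSpace.basisFun (Fin 3) ℝ j))
  refine h.congr_far (R₁ := afRadius a r₀) fun z hz ↦ ?_
  rw [_root_.sub_apply, _root_.sub_apply, _root_.sub_apply, _root_.sub_apply,
    hCoeff_afEnd_data_apply hM a r₀ hz, Minkowski.bilin_ofTimeSpace_zero, innerSL_apply_apply]

/-- **`k ∈ O_k(ρ⁻²)` on the Kerr end**, for every spin and every `k`: componentwise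
`k_ij(z) = K_ν((0, eᵢ), (0, eⱼ))` far out (`kCoeff_afEnd_data_apply`), which is the coordinate
expression of `secondFundamentalForm_sliceEmbed_eq`, a symbol of order `ρ⁻²`
(`isBigOSmooth_secondFundamentalFormRep`). Cook 2000, §3.2.2, (57); Bartnik–Isenberg 2004, §2.
[cite: Cook2000, §3.2.2 (57)] -/
theorem isBigOSmooth_kCoeff {M : ℝ} (hM : 0 ≤ M) (a r₀ : ℝ) (k : ℕ) :
    IsBigOSmooth k (-2) fun z : E3 ↦ AFEnd.kCoeff (afEnd a r₀) (data M a r₀ hM) z := by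
  refine IsBigOSmooth.of_bilinForm_apply (EuclideanSpace.basisFun (Fin 3) ℝ) fun i j ↦ ?_
  refine (isBigOSmooth_secondFundamentalFormRep M a k (EuclideanSpace.basisFun (Fin 3) ℝ i)
    (EuclideanSpace.basisFun (Fin 3) ℝ j)).congr_far (R₁ := afRadius a r₀) fun z hz ↦ ?_
  rw [kCoeff_afEnd_data_apply hM a r₀ hz, sliceK_apply, secondFundamentalForm_sliceEmbed_eq hM]

end Decay

/-! ### Asymptotic flatness -/

/-- **The Kerr–Schild slice data are asymptotically flat of order `1` on the Kerr end**, for every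
spin: `h − δ = O₂(ρ⁻¹)` (`isBigOSmooth_hCoeff_sub` with `k = 2`) and `k = O₁(ρ⁻²)`
(`isBigOSmooth_kCoeff` with `k = 1`). Bartnik 1986, Def. 2.1; Bartnik–Isenberg 2004, §2; Cook
2000, §3.2.2; García-Parrado–Valiente Kroon 2008, §5. [cite: Bartnik1986, Def. 2.1] -/
theorem isAsymptoticallyFlat_afEnd_data [Facts] [SliceFacts] {M : ℝ} (hM : 0 ≤ M) (a r₀ : ℝ) :
    (afEnd a r₀).IsAsymptoticallyFlat (data M a r₀ hM) 1 := by
  refine ⟨fun m hm ↦ ?_, fun m hm ↦ ?_⟩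
  · refine ((isBigOSmooth_hCoeff_sub hM a r₀ 2).isBigO hm).congr_right fun x ↦ ?_
    norm_num
  · refine ((isBigOSmooth_kCoeff hM a r₀ 1).isBigO hm).congr_right fun x ↦ ?_
    norm_num

/-- **Discharge of the named fact `Kerr.isAsymptoticallyFlat_data`** (`KerrData.lean`), verbatim
and for all `M, a, r₀`: under its leading binder `0 ≤ M`, the Kerr data are asymptotically flat
of order `1` on `Kerr.afEnd a r₀`. Bartnik 1986, Def. 2.1; Cook 2000, §3.2.2;
García-Parrado–Valiente Kroon 2008, §5. [cite: Bartnik1986, Def. 2.1] -/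
theorem isAsymptoticallyFlat_data_holds [Facts] [SliceFacts] (M a r₀ : ℝ) :
    isAsymptoticallyFlat_data M a r₀ :=
  fun hM ↦ isAsymptoticallyFlat_afEnd_data hM a r₀

end Kerr

end Literature.Geometry.Lorentzian

end
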